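import Summits.CriticalPhenomena.Ising3DConformalLimit.Theorems.HyperoctahedralRPExistsScaleCovariantLimitFoldedCurrentSpectralEdgeCore
import HarnessLib

/-!
# Doubling at the spectral edge ⟹ doubling of the moments — the Tauberian direction
# (crux `ExistsScaleCovariantLimit`, stmt-CriticalPhenomena-1981, line `folded-current-repulsion`, F2 record)

Companion of `…FoldedCurrentSpectralEdgeCore` (Chebyshev `cheb`, the split estimate `split`, and the Abelian
direction `edgeDoubling_of_doubling`). Here: the TAUBERIAN direction (registered sub-goal
`doubling_of_edgeDoubling`). For a Hausdorff moment sequence `g(n) = ∫_{[0,1]} tⁿ dμ` that is positive, has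
one-step ratios bounded below (`r g(k) ≤ g(k+1)`, `k ≥ 1`) and a lower envelope `c ≤ n² g(n)`: if `μ` is a
doubling measure at the spectral edge `λ = 1` (`μ[e^{-2y},1] ≤ K μ[e^{-y},1]` for `0 < y ≤ y₀`) then `g` is
DOUBLING, `κ g(n) ≤ g(2n)` for all `n ≥ 1`.

Steps: (1) `edge_pos` — the edge carries mass at every gap (else `g(n) ≤ e^{-ny₀/2} g(0)`, against the
envelope, `x² e^{-x} → 0`), so doubling holds for ALL `y > 0` with `K' = max K (g(0)/μ[e^{-y₀},1])`;
(2) `edge_iterate` — `a` doublings: `μ[e^{-2^a y},1] ≤ K'^a μ[e^{-y},1]`; (3) `exists_pow_mul_exp_le` — choose `a`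
with `K'^a e^{-2^{a-1}} ≤ r²/(4e²)` (double-exponential beats exponential: `x^{log₂K'} e^{-x/2} → 0` along
`x = 2^a`); (4) the split estimate with `L = 2^a` plus Chebyshev at scale `2n` give
`g(n) ≤ e²K'^a g(2n) + e^{-2^{a-1}} g(⌊n/2⌋)`, and a strong induction on `n` (ratio bound to pass from `⌊n/2⌋`
back to `n`) yields `κ = min (1/(2e²K'^a)) r`.

With the Abelian direction this is the O-regular-variation Tauberian theorem for Laplace–Stieltjes transforms
(de Haan–Stadtmüller 1985; Bingham–Goldie–Teugels §2.10) in the special case needed for item 6150, with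
explicit constants; the Ising instance is `…FoldedCurrentSpectralEdgeDoubling`.

References: N. H. Bingham, C. M. Goldie, J. L. Teugels, *Regular Variation* (CUP 1987), §2.10
[BinghamGoldieTeugels1987]; L. de Haan, U. Stadtmüller, J. Math. Anal. Appl. 108 (1985) 344–365
[deHaanStadtmuller1985]; M. Aizenman, H. Duminil-Copin, Ann. of Math. 194 (2021), arXiv:1912.07973,
Remark 5.10 [AizenmanDuminilCopinAnnals2021].
-/

noncomputable section

open MeasureTheory Set Filter Real
open scoped Topology

namespace Summit.CriticalPhenomena.Ising3DConformalLimit.Cruxes.ExistsScaleCovariantLimit.FoldedCurrentRepulsion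

namespace SpectralEdge

variable {μ : Measure ℝ} {g : ℕ → ℝ}

/-! ### 4. The Tauberian direction: doubling at the spectral edge ⟹ doubling of the moments -/

/-- **The edge carries mass at every gap**: if the moments obey a lower envelope `c ≤ n² g(n)` then
`μ[e^{-y₀}, 1] > 0` for every `y₀ > 0` (otherwise `g(n) ≤ e^{-n y₀/2} g(0)` by the split estimate, against
the envelope since `n² e^{-n y₀/2} → 0`). [cite: BinghamGoldieTeugels1987, §2.10] -/
theorem edge_pos [IsFiniteMeasure μ] (hsupp : μ (Icc (0:ℝ) 1)ᶜ = 0)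
    (hrep : ∀ n : ℕ, g n = ∫ t, t ^ n ∂μ) (hpos : ∀ n, 0 < g n)
    {c : ℝ} (hc : 0 < c) (henv : ∀ n : ℕ, 1 ≤ n → c ≤ (n : ℝ) ^ 2 * g n)
    {y₀ : ℝ} (hy₀ : 0 < y₀) :
    0 < μ.real (Icc (Real.exp (-y₀)) 1) := by
  by_contra hU
  push Not at hU
  have hU0 : μ.real (Icc (Real.exp (-y₀)) 1) = 0 := le_antisymm hU measureReal_nonneg
  have hM : 0 < g 0 := hpos 0
  set B : ℝ := (2 / y₀) ^ 2 * g 0 with hB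
  have hBpos : 0 < B := by positivity
  -- the envelope against the split estimate with `L = n y₀`
  have hbound : ∀ n : ℕ, 1 ≤ n →
      c ≤ B * ((((n : ℝ) * (y₀ / 2)) ^ 2) * Real.exp (-((n : ℝ) * (y₀ / 2)))) := by
    intro n hn
    have hn' : (0:ℝ) < n := by exact_mod_cast hn
    have hs := split hsupp hrep hn (L := n * y₀) (by positivity)
    have e1 : (n : ℝ) * y₀ / n = y₀ := by field_simp
    rw [e1, hU0, zero_add] at hs
    have hg2 : g (n / 2) ≤ g 0 := moment_antitone hsupp hrep (Nat.zero_le _)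
    have e2 : Real.exp (-((n : ℝ) * y₀ / 2)) = Real.exp (-((n : ℝ) * (y₀ / 2))) := by ring_nf
    calc c ≤ (n : ℝ) ^ 2 * g n := henv n hn
      _ ≤ (n : ℝ) ^ 2 * (Real.exp (-((n : ℝ) * y₀ / 2)) * g 0) := by
          refine mul_le_mul_of_nonneg_left ?_ (by positivity)
          exact hs.trans (mul_le_mul_of_nonneg_left hg2 (Real.exp_pos _).le)
      _ = B * ((((n : ℝ) * (y₀ / 2)) ^ 2) * Real.exp (-((n : ℝ) * (y₀ / 2)))) := by
          rw [e2, hB]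
          field_simp
  -- `x² e^{-x} → 0` along `x = n y₀/2`
  have hT : Tendsto (fun n : ℕ => (((n : ℝ) * (y₀ / 2)) ^ 2) * Real.exp (-((n : ℝ) * (y₀ / 2))))
      atTop (𝓝 0) := by
    have h1 := Real.tendsto_pow_mul_exp_neg_atTop_nhds_zero 2
    have h2 : Tendsto (fun n : ℕ => (n : ℝ) * (y₀ / 2)) atTop atTop :=
      tendsto_natCast_atTop_atTop.atTop_mul_const (by positivity)
    exact h1.comp h2
  have hε : 0 < c / B := div_pos hc hBpos
  obtain ⟨n, hn1, hn2⟩ := ((eventually_ge_atTop 1).and (hT.eventually (Iio_mem_nhds hε))).exists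
  have h := hbound n hn1
  have : B * ((((n : ℝ) * (y₀ / 2)) ^ 2) * Real.exp (-((n : ℝ) * (y₀ / 2)))) < B * (c / B) :=
    mul_lt_mul_of_pos_left hn2 hBpos
  rw [mul_div_cancel₀ _ hBpos.ne'] at this
  linarith

/-- **Iterated global doubling**: if `U(2y) ≤ K' U(y)` for all `y > 0` then `U(2^a y) ≤ K'^a U(y)`. [folklore] -/
theorem edge_iterate [IsFiniteMeasure μ] {K' : ℝ} (hK' : 0 ≤ K')
    (hglob : ∀ y : ℝ, 0 < y → μ.real (Icc (Real.exp (-(2 * y))) 1) ≤ K' * μ.real (Icc (Real.exp (-y)) 1))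
    (a : ℕ) {y : ℝ} (hy : 0 < y) :
    μ.real (Icc (Real.exp (-((2:ℝ) ^ a * y))) 1) ≤ K' ^ a * μ.real (Icc (Real.exp (-y)) 1) := by
  induction a with
  | zero => simp
  | succ a ih =>
    have h := hglob ((2:ℝ) ^ a * y) (by positivity)
    have e : (2:ℝ) ^ (a + 1) * y = 2 * ((2:ℝ) ^ a * y) := by ring
    rw [e]
    calc μ.real (Icc (Real.exp (-(2 * ((2:ℝ) ^ a * y)))) 1) ≤ K' * μ.real (Icc (Real.exp (-((2:ℝ) ^ a * y))) 1) := h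
      _ ≤ K' * (K' ^ a * μ.real (Icc (Real.exp (-y)) 1)) := mul_le_mul_of_nonneg_left ih hK'
      _ = K' ^ (a + 1) * μ.real (Icc (Real.exp (-y)) 1) := by ring

/-- **Double-exponential beats exponential**: for `K' > 0` and `η > 0` there is `a` with
`K'^a · e^{-2^a/2} ≤ η`. [folklore] -/
theorem exists_pow_mul_exp_le {K' : ℝ} (hK' : 0 < K') {η : ℝ} (hη : 0 < η) :
    ∃ a : ℕ, K' ^ a * Real.exp (-((2:ℝ) ^ a / 2)) ≤ η := by
  have h1 := tendsto_rpow_mul_exp_neg_mul_atTop_nhds_zero (Real.logb 2 K') (1 / 2) (by norm_num)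
  have h2 : Tendsto (fun a : ℕ => (2:ℝ) ^ a) atTop atTop := tendsto_pow_atTop_atTop_of_one_lt one_lt_two
  have h3 := h1.comp h2
  have hT : Tendsto (fun a : ℕ => K' ^ a * Real.exp (-((2:ℝ) ^ a / 2))) atTop (𝓝 0) := by
    refine h3.congr fun a => ?_
    simp only [Function.comp_apply]
    have hr : ((2:ℝ) ^ a) ^ Real.logb 2 K' = K' ^ a := by
      rw [← Real.rpow_natCast 2 a, ← Real.rpow_mul (by norm_num : (0:ℝ) ≤ 2), mul_comm,
        Real.rpow_mul (by norm_num : (0:ℝ) ≤ 2), Real.rpow_logb (by norm_num) (by norm_num) hK',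
        Real.rpow_natCast]
    rw [hr]
    congr 1
    congr 1
    ring
  exact (hT.eventually (Iic_mem_nhds hη)).exists

/-- **TAUBERIAN DIRECTION OF THE DICTIONARY** (registered sub-goal `doubling_of_edgeDoubling` of item 1981,
abstract form): let `g(n) = ∫_{[0,1]} tⁿ dμ` be positive with one-step ratios bounded below (`r g(k) ≤ g(k+1)`,
`k ≥ 1`) and a lower envelope `c ≤ n² g(n)` (`n ≥ 1`). If `μ` is doubling at the spectral edge (`μ[e^{-2y},1] ≤
K μ[e^{-y},1]`, `0 < y ≤ y₀`) then `g` is DOUBLING: `κ g(n) ≤ g(2n)` for all `n ≥ 1`. Mechanism: the edge carries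
mass at every gap (`edge_pos`), so doubling holds for all `y > 0` with `K' = max K (g(0)/μ[e^{-y₀},1])`; the split
estimate with `L = 2^a`, `a` doublings down to gap `1/n` and Chebyshev give
`g(n) ≤ e² K'^a g(2n) + e^{-2^{a-1}} g(⌊n/2⌋)`, and for `a` with `K'^a e^{-2^{a-1}} ≤ r²/(4e²)` a strong induction on
`n` closes with `κ = min (1/(2e²K'^a)) r`. [cite: BinghamGoldieTeugels1987, §2.10] [cite: deHaanStadtmuller1985, Thm 1] -/
theorem doubling_of_edgeDoubling : ∀ {μ : MeasureTheory.Measure ℝ} {g : ℕ → ℝ}, MeasureTheory.IsFiniteMeasure μ → μ (Set.Icc (0:ℝ) 1)ᶜ = 0 → (∀ n : ℕ, g n = ∫ t, t ^ n ∂μ) → (∀ n : ℕ, 0 < g n) → (∃ r : ℝ, 0 < r ∧ ∀ k : ℕ, 1 ≤ k → r * g k ≤ g (k + 1)) → (∃ c : ℝ, 0 < c ∧ ∀ n : ℕ, 1 ≤ n → c ≤ (n : ℝ) ^ 2 * g n) → (∃ K y₀ : ℝ, 0 < K ∧ 0 < y₀ ∧ ∀ y ∈ Set.Ioc (0:ℝ)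 y₀, μ.real (Set.Icc (Real.exp (-(2 * y))) 1) ≤ K * μ.real (Set.Icc (Real.exp (-y)) 1)) → ∃ κ : ℝ, 0 < κ ∧ ∀ n : ℕ, 1 ≤ n → κ * g n ≤ g (2 * n) := by
  intro μ g hfin hsupp hrep hpos hr hc hK
  obtain ⟨r, hr, hratio⟩ := hr
  obtain ⟨c, hc, henv⟩ := hc
  obtain ⟨K, y₀, hK, hy₀, hdbl⟩ := hK
  have hr1 : r ≤ 1 := by
    have h := hratio 1 le_rfl
    have h2 : g (1 + 1) ≤ g 1 := moment_succ_le hsupp hrep 1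
    nlinarith [hpos 1]
  -- Step 1: the edge carries mass at gap `y₀`; Step 2: global doubling constant
  have hUpos : 0 < μ.real (Icc (Real.exp (-y₀)) 1) := edge_pos hsupp hrep hpos hc henv hy₀
  set M : ℝ := g 0 with hM
  have hMpos : 0 < M := hpos 0
  set K' : ℝ := max K (M / μ.real (Icc (Real.exp (-y₀)) 1)) with hK'
  have hK'pos : 0 < K' := lt_max_of_lt_left hK
  have hglob : ∀ y : ℝ, 0 < y →
      μ.real (Icc (Real.exp (-(2 * y))) 1) ≤ K' * μ.real (Icc (Real.exp (-y)) 1) := by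
    intro y hy
    by_cases hyy : y ≤ y₀
    · exact (hdbl y ⟨hy, hyy⟩).trans
        (mul_le_mul_of_nonneg_right (le_max_left _ _) measureReal_nonneg)
    · push Not at hyy
      have h1 : μ.real (Icc (Real.exp (-(2 * y))) 1) ≤ M := edge_le_moment_zero hrep _
      have h2 : μ.real (Icc (Real.exp (-y₀)) 1) ≤ μ.real (Icc (Real.exp (-y)) 1) := edge_mono hyy.le
      calc μ.real (Icc (Real.exp (-(2 * y))) 1) ≤ M := h1
        _ = (M / μ.real (Icc (Real.exp (-y₀)) 1)) * μ.real (Icc (Real.exp (-y₀)) 1) := by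
            field_simp
        _ ≤ K' * μ.real (Icc (Real.exp (-y)) 1) :=
            mul_le_mul (le_max_right _ _) h2 measureReal_nonneg hK'pos.le
  -- Step 3: the choice of `a`
  have hη : 0 < r ^ 2 / (4 * Real.exp 2) := by positivity
  obtain ⟨a, ha⟩ := exists_pow_mul_exp_le hK'pos hη
  set ε : ℝ := Real.exp (-((2:ℝ) ^ a / 2)) with hε
  have hεpos : 0 < ε := Real.exp_pos _
  set C₁ : ℝ := Real.exp 2 * K' ^ a with hC₁
  have hC₁pos : 0 < C₁ := by positivity
  -- `4 ε C₁ ≤ r` and `2 ε ≤ r²`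
  have hK'a1 : 1 ≤ K' ^ a := by
    refine one_le_pow₀ ?_
    refine le_trans ?_ (le_max_right _ _)
    rw [le_div_iff₀ hUpos, one_mul]
    exact edge_le_moment_zero hrep _
  have hεle : ε ≤ K' ^ a * ε := le_mul_of_one_le_left hεpos.le hK'a1
  have hcond1 : 4 * ε * C₁ ≤ r := by
    have : K' ^ a * ε ≤ r / (4 * Real.exp 2) := by
      refine ha.trans ?_
      rw [div_le_div_iff_of_pos_right (by positivity)]
      nlinarith
    rw [le_div_iff₀ (by positivity)] at this
    calc 4 * ε * C₁ = K' ^ a * ε * (4 * Real.exp 2) := by rw [hC₁]; ring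
      _ ≤ r := this
  have hcond2 : 2 * ε ≤ r ^ 2 := by
    have : K' ^ a * ε ≤ r ^ 2 / (4 * Real.exp 2) := ha
    rw [le_div_iff₀ (by positivity)] at this
    have he : (1:ℝ) ≤ Real.exp 2 := Real.one_le_exp (by norm_num)
    nlinarith
  -- Step 4: the doubling constant and the strong induction
  set δ : ℝ := min (1 / (2 * C₁)) r with hδ
  have hδpos : 0 < δ := lt_min (by positivity) hr
  have hδr : δ ≤ r := min_le_right _ _
  have hδC : δ ≤ 1 / (2 * C₁) := min_le_left _ _
  have h2ε : 2 * ε ≤ r * δ := by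
    rw [hδ, mul_min_of_nonneg _ _ hr.le]
    refine le_min ?_ (by nlinarith)
    rw [mul_one_div, le_div_iff₀ (by positivity)]
    nlinarith
  refine ⟨δ, hδpos, fun n => ?_⟩
  induction n using Nat.strong_induction_on with
  | _ n ih =>
    intro hn
    rcases (show n = 1 ∨ 2 ≤ n by omega) with rfl | hn2
    · -- base: `δ g(1) ≤ r g(1) ≤ g(2)`
      calc δ * g 1 ≤ r * g 1 := mul_le_mul_of_nonneg_right hδr (hpos 1).le
        _ ≤ g (1 + 1) := hratio 1 le_rfl
    · have hn' : (0:ℝ) < n := by exact_mod_cast (show 0 < n by omega)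
      -- (1) split with `L = 2^a`
      have hs := split hsupp hrep (show 1 ≤ n by omega) (L := (2:ℝ) ^ a) (by positivity)
      -- (2) `a` doublings from gap `2^a/n` down to `1/n`
      have hit := edge_iterate hK'pos.le hglob a (y := 1 / n) (by positivity)
      have e1 : (2:ℝ) ^ a / n = (2:ℝ) ^ a * (1 / n) := by ring
      rw [e1] at hs
      -- (3) Chebyshev at scale `2n` with `c = 2`: `U(1/n) ≤ e² g(2n)`
      have hch := cheb hsupp hrep (2 * n) (c := 2) (by norm_num)
      have e2 : (2:ℝ) / ((2 * n : ℕ) : ℝ) = 1 / n := by push_cast; field_simp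
      rw [e2] at hch
      have hU : μ.real (Icc (Real.exp (-(1 / (n : ℝ)))) 1) ≤ Real.exp 2 * g (2 * n) := by
        have hee : Real.exp 2 * Real.exp (-2) = 1 := by rw [← Real.exp_add]; norm_num
        calc μ.real (Icc (Real.exp (-(1 / (n : ℝ)))) 1)
            = (Real.exp 2 * Real.exp (-2)) * μ.real (Icc (Real.exp (-(1 / (n : ℝ)))) 1) := by rw [hee, one_mul]
          _ = Real.exp 2 * (Real.exp (-2) * μ.real (Icc (Real.exp (-(1 / (n : ℝ)))) 1)) := mul_assoc _ _ _
          _ ≤ Real.exp 2 * g (2 * n) := mul_le_mul_of_nonneg_left hch (Real.exp_pos _).le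
      -- (4) induction hypothesis at `⌊n/2⌋`
      have hm1 : 1 ≤ n / 2 := by omega
      have hIH : δ * g (n / 2) ≤ g (2 * (n / 2)) := ih (n / 2) (by omega) hm1
      have ha2 : g (2 * (n / 2)) ≤ g (n - 1) := moment_antitone hsupp hrep (by omega)
      have hra : r * g (n - 1) ≤ g n := by
        have := hratio (n - 1) (by omega)
        rwa [Nat.sub_add_cancel (by omega : 1 ≤ n)] at this
      have h4 : r * δ * g (n / 2) ≤ g n := by
        calc r * δ * g (n / 2) = r * (δ * g (n / 2)) := by ring
          _ ≤ r * g (n - 1) := mul_le_mul_of_nonneg_left (hIH.trans ha2) hr.le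
          _ ≤ g n := hra
      -- (5) combine
      have hg2 : 0 ≤ g (n / 2) := (hpos _).le
      have hlow : 2 * (ε * g (n / 2)) ≤ g n := by
        calc 2 * (ε * g (n / 2)) = (2 * ε) * g (n / 2) := by ring
          _ ≤ (r * δ) * g (n / 2) := mul_le_mul_of_nonneg_right h2ε hg2
          _ = r * δ * g (n / 2) := by ring
          _ ≤ g n := h4
      have hmain : g n ≤ C₁ * g (2 * n) + ε * g (n / 2) := by
        calc g n ≤ μ.real (Icc (Real.exp (-((2:ℝ) ^ a * (1 / (n : ℝ))))) 1) + ε * g (n / 2) := hs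
          _ ≤ K' ^ a * μ.real (Icc (Real.exp (-(1 / (n : ℝ)))) 1) + ε * g (n / 2) := by linarith [hit]
          _ ≤ K' ^ a * (Real.exp 2 * g (2 * n)) + ε * g (n / 2) := by
              have := mul_le_mul_of_nonneg_left hU (le_of_lt (by positivity : (0:ℝ) < K' ^ a))
              linarith
          _ = C₁ * g (2 * n) + ε * g (n / 2) := by rw [hC₁]; ring
      have hfin : g n ≤ 2 * C₁ * g (2 * n) := by linarith
      calc δ * g n ≤ (1 / (2 * C₁)) * g n := mul_le_mul_of_nonneg_right hδC (hpos n).le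
        _ ≤ (1 / (2 * C₁)) * (2 * C₁ * g (2 * n)) := mul_le_mul_of_nonneg_left hfin (by positivity)
        _ = g (2 * n) := by field_simp

end SpectralEdge

end Summit.CriticalPhenomena.Ising3DConformalLimit.Cruxes.ExistsScaleCovariantLimit.FoldedCurrentRepulsion

end
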